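import Literature.Analysis.ValidatedNumerics.MultiPrecisionInterval
import Literature.NumberTheory.LFunctions.EulerMaclaurinZetaHigher
import HarnessLib

/-!
# Certified multi-precision evaluation of `ζ(s)` on `Re s > 0`

Trunk T-ANT (NumberTheory/LFunctions). An executable evaluator producing a complex box
(`Literature.Analysis.ValidatedNumerics.NumericsMP.MC`) that is *proved* to contain `ζ(s)` for every `s` in a given input box
(`Re s > 0`, `s ≠ 1`), by the Euler–Maclaurin formula of arbitrary order
(`Literature.NumberTheory.LFunctions.riemannZeta_eq_eulerMaclaurin_of_re_pos`, `EulerMaclaurinZetaHigher.lean`) evaluated in the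
multi-precision interval arithmetic of `MultiPrecisionInterval.lean`, with the explicit remainder
bound `Literature.NumberTheory.LFunctions.norm_emRemHigher_le_rat`. Because the input is a box, the output encloses
`ζ` on a whole rectangle of `s` at once (inclusion monotonicity), which is what certificates over
segments (winding-number / argument-principle certificates, `WindingCertificate.lean`) consume.

This is the engine of the certified version of the Odlyzko–te Riele computation
(`MertensConjectureDisproof.lean`, `OdlyzkoTeRiele1985_numerics`): values of `ζ(½ + it)` to
`~90` digits near the first 2000 zeros, and of `ζ(x + 2516 i)`, `½ ≤ x ≤ 2`.

## Algorithm

With tables `logs[n] ∋ log n` (`1 ≤ n ≤ N`) and `piI ∋ π` at scale `S`: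
* `n^{-s} = e^{-σ log n} · e^{-i t log n}` is evaluated afresh (`MI.exp`, `MC.expI`) only at the
  primes; for composite `n = p · (n/p)` (`p = Nat.minFac n`) it is the product of two earlier table
  entries (`powTable`; `Complex.natCast_mul_natCast_cpow`).
* main part `Σ_{n<N} n^{-s} + N^{1-s}/(s-1) + ½N^{-s}` (`Literature.NumberTheory.LFunctions.emMainZero`);
* correction terms `T_1 = s N^{-s}/(12 N)`, `T_{k+1} = T_k · r_k · (s+2k-1)(s+2k)/N²` with the exact
  rational ratios `r_k = (B_{2k+2}/(2k+2)!)/(B_{2k}/(2k)!)` from a memoised table of Bernoulli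
  numbers proved equal to Mathlib's `bernoulli` (`bernArr_spec`);
* remainder radius from `‖s(s+1)⋯(s+2ν)‖ ≤ Π (|σ+j| + |t|)` and `norm_emRemHigher_le_rat`.

## Main definitions and results (namespace `Literature.ZetaNumerics`)

* `bernArr m` (memoised `B'_0, …, B'_{m-1}`), `bernArr_spec`; `bernoulliQ m n = bernoulli n`
  (`bernoulliQ_eq`), `emCoeff k = B_{2k}/(2k)!`, `emCoeffList`.
* `Tables` (scale, truncation `N`, order `ν`, `π`, `log n`, Taylor parameters), `Tables.Valid`,
  `mkTables`, `mkTables_valid`.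
* `cpowFresh`, `powTable`, `mainBox`, `termsBox`, `remRadius`, **`zetaBox`**.
* **`mem_zetaBox`** — `Tables.Valid T → s ∈ sB → 0 < lo (re sB) → s ≠ 1 → zetaBox T sB = some Z →
  ζ(s) ∈ Z`.

## References

* H. M. Edwards, *Riemann's Zeta Function* (1974), §6.4 (Euler–Maclaurin for `ζ`). [Edwards1974]
* A. M. Odlyzko, H. J. J. te Riele, *Disproof of the Mertens conjecture*, J. reine angew. Math.
  357 (1985), §4.2 (the first 2000 zeros to 100 digits "using the Euler–Maclaurin formula").
  [OdlyzkoTeRiele1985]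
-/

open Finset Complex
open Literature.Analysis.ValidatedNumerics.NumericsMP Literature.NumberTheory.LFunctions

namespace Literature.NumberTheory.LFunctions.ZetaNumerics

/-! ## Bernoulli numbers, memoised -/

/-- The next value of `bernoulli'` from the array of the previous ones:
`B'_n = 1 - Σ_{k<n} C(n,k)/(n-k+1) · B'_k` (`A = #[B'_0, …, B'_{n-1}]`). [folklore] -/
def bernNext (A : Array ℚ) : ℚ :=
  let n := A.size
  1 - ∑ k ∈ range n, (n.choose k : ℚ) / (n - k + 1) * A.getD k 0

/-- `bernArr m = #[B'_0, …, B'_{m-1}]` (Mathlib's `bernoulli'`, i.e. `B'_1 = +1/2`), computed by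
the defining recursion with memoisation (quadratic time). [folklore] -/
def bernArr : ℕ → Array ℚ
  | 0 => #[]
  | m + 1 => let A := bernArr m; A.push (bernNext A)

/-- [folklore] -/
lemma bernArr_size : ∀ m, (bernArr m).size = m
  | 0 => rfl
  | m + 1 => by simp [bernArr, bernArr_size m]

/-- `bernArr` computes `bernoulli'`. [folklore] -/
theorem bernArr_spec : ∀ (m k : ℕ), k < m → (bernArr m).getD k 0 = bernoulli' k
  | 0, k, hk => absurd hk (Nat.not_lt_zero k)
  | m + 1, k, hk => by
    simp only [bernArr]
    have hsz := bernArr_size m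
    rcases Nat.lt_succ_iff_lt_or_eq.1 hk with h | h
    · have h' : k < (bernArr m).size := by rw [hsz]; exact h
      rw [Array.getD_eq_getD_getElem?, Array.getElem?_push_lt h', Option.getD_some]
      have := bernArr_spec m k h
      rw [Array.getD_eq_getD_getElem?, getElem?_pos _ k h', Option.getD_some] at this
      exact this
    · subst h
      have hidx : ((bernArr k).push (bernNext (bernArr k)))[k]? = some (bernNext (bernArr k)) := by
        rw [Array.getElem?_push, if_pos hsz.symm]
      rw [Array.getD_eq_getD_getElem?, hidx, Option.getD_some, bernNext, bernoulli'_def, hsz]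
      congr 1
      refine sum_congr rfl fun j hj ↦ ?_
      rw [bernArr_spec k j (mem_range.1 hj)]

/-- The Bernoulli numbers `B_0, …, B_{m-1}` (Mathlib's `bernoulli`, `B_1 = -1/2`), computably,
as a function of the index, from one memoised array. [folklore] -/
def bernoulliQ (m : ℕ) (n : ℕ) : ℚ := (-1) ^ n * (bernArr m).getD n 0

/-- [folklore] -/
theorem bernoulliQ_eq {m n : ℕ} (h : n < m) : bernoulliQ m n = bernoulli n := by
  rw [bernoulliQ, bernArr_spec m n h, bernoulli]

/-- The Euler–Maclaurin coefficient `c_k = B_{2k}/(2k)!`. [folklore] -/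
def emCoeff (k : ℕ) : ℚ := bernoulli (2 * k) / (2 * k).factorial

/-- `c_k` read off a Bernoulli array `A = #[B'_0, B'_1, …]`. [folklore] -/
def coeffOfArr (A : Array ℚ) (k : ℕ) : ℚ := (-1) ^ (2 * k) * A.getD (2 * k) 0 / (2 * k).factorial

/-- The coefficients `c_0, …, c_{ν+1}` computed from one Bernoulli array (built once).
[folklore] -/
def emCoeffList (ν : ℕ) : List ℚ :=
  let A := bernArr (2 * ν + 4)
  (List.range (ν + 2)).map (coeffOfArr A)

/-- [folklore] -/
lemma emCoeffList_getD {ν j : ℕ} (hj : j < ν + 2) : (emCoeffList ν).getD j 0 = emCoeff j := by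
  rw [emCoeffList, List.getD_eq_getElem?_getD, List.getElem?_map, List.getElem?_range hj]
  simp only [Option.map_some, Option.getD_some, coeffOfArr]
  rw [← bernoulliQ, bernoulliQ_eq (by omega), emCoeff]

/-- The list of ratios `r_k = c_{k+1}/c_k`, `k = 1, …, ν-1`, together with the check that no
`c_k` (`1 ≤ k ≤ ν - 1`) vanishes (so that `c_{k+1} = c_k r_k`). [folklore] -/
def emRatios (ν : ℕ) : Option (List ℚ) :=
  let cs := emCoeffList ν
  if (List.range (ν - 1)).all (fun i ↦ decide (cs.getD (i + 1) 0 ≠ 0)) then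
    some ((List.range (ν - 1)).map fun i ↦ cs.getD (i + 2) 0 / cs.getD (i + 1) 0)
  else none

/-! ## Tables -/

/-- The data of an evaluation: scale `S`, truncation point `N`, order `ν`, enclosures of `π` and of
`log n` (`n ≤ N`) at scale `S`, the Euler–Maclaurin ratios, and the Taylor/argument-reduction
parameters of `exp`, `expI`. [folklore] -/
structure Tables where
  /-- scale -/
  S : ℕ
  /-- truncation point of the Euler–Maclaurin main sum -/
  N : ℕ
  /-- number of Bernoulli correction terms -/
  nu : ℕ
  /-- enclosure of `π` at scale `S` -/
  piI : MI
  /-- `logs[n]` encloses `log n` for `1 ≤ n ≤ N` (index `0` unused) -/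
  logs : Array MI
  /-- the ratios `r_1, …, r_{ν-1}` -/
  ratios : List ℚ
  /-- Taylor terms for the real exponential -/
  Kexp : ℕ
  /-- halvings for the real exponential -/
  kexp : ℕ
  /-- Taylor terms for `expI` -/
  KI : ℕ
  /-- halvings for `expI` -/
  kI : ℕ

/-- Validity of tables: positive scale, `N ≥ 2`, `ν ≥ 1`, correct enclosures, correct ratios.
[folklore] -/
structure Tables.Valid (T : Tables) : Prop where
  S_pos : 0 < T.S
  two_le_N : 2 ≤ T.N
  nu_ne : T.nu ≠ 0
  mem_pi : MI.mem T.S Real.pi T.piI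
  logs_size : T.logs.size = T.N + 1
  mem_logs : ∀ n : ℕ, 1 ≤ n → n ≤ T.N → MI.mem T.S (Real.log n) (T.logs.getD n default)
  ratios_eq : emRatios T.nu = some T.ratios

/-- Build the `log` table `[junk, log 1, …, log N]` at scale `S` from evaluations at the finer
scale `S'` (`none` on failure). [folklore] -/
def mkLogs (S S' Klog : ℕ) : ℕ → Option (Array MI)
  | 0 => some #[default]
  | n + 1 =>
    match mkLogs S S' Klog n, MI.logNat S' Klog (n + 1) with
    | some A, some L => some (A.push (MI.rescale S' S L))
    | _, _ => none

/-- Build tables: `π` and the logarithms are computed at scale `S · 2^guard` and rounded to `S`.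
[folklore] -/
def mkTables (S N nu guard Klog Kpi Kexp kexp KI kI : ℕ) : Option Tables :=
  let S' := S * 2 ^ guard
  if 0 < S ∧ 2 ≤ N ∧ nu ≠ 0 then
    match MI.pi S' Kpi, mkLogs S S' Klog N, emRatios nu with
    | some P, some A, some R =>
        some ⟨S, N, nu, MI.rescale S' S P, A, R, Kexp, kexp, KI, kI⟩
    | _, _, _ => none
  else none

/-- Soundness of `mkLogs`: size `n + 1` and `log m ∈ logs[m]` for `1 ≤ m ≤ n`. [folklore] -/
lemma mkLogs_spec {S S' Klog : ℕ} (hS' : 0 < S') :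
    ∀ (n : ℕ) {A : Array MI}, mkLogs S S' Klog n = some A →
      A.size = n + 1 ∧ ∀ m : ℕ, 1 ≤ m → m ≤ n → MI.mem S (Real.log m) (A.getD m default)
  | 0, A, h => by
    simp only [mkLogs, Option.some.injEq] at h
    subst h
    exact ⟨rfl, fun m h1 h2 ↦ by omega⟩
  | n + 1, A, h => by
    simp only [mkLogs] at h
    split at h
    · rename_i A0 L hA0 hL
      simp only [Option.some.injEq] at h
      subst h
      obtain ⟨hsz, hmem⟩ := mkLogs_spec hS' n hA0
      refine ⟨by simp [hsz], fun m h1 h2 ↦ ?_⟩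
      rcases Nat.lt_succ_iff_lt_or_eq.1 (Nat.lt_succ_of_le h2) with hlt | heq
      · have hm : m ≤ n := Nat.lt_succ_iff.1 hlt
        have hlt' : m < A0.size := by rw [hsz]; omega
        have := hmem m h1 hm
        rw [Array.getD_eq_getD_getElem?, Array.getElem?_push_lt hlt', Option.getD_some]
        rw [Array.getD_eq_getD_getElem?, getElem?_pos A0 m hlt', Option.getD_some] at this
        exact this
      · subst heq
        have hidx : (A0.push (MI.rescale S' S L))[n + 1]? = some (MI.rescale S' S L) := by
          rw [← hsz]; exact Array.getElem?_push_size
        rw [Array.getD_eq_getD_getElem?, hidx, Option.getD_some]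
        have := MI.mem_logNat hS' hL
        push_cast at this ⊢
        exact MI.mem_rescale hS' S this
    · simp at h

/-- Tables built by `mkTables` are valid. [folklore] -/
theorem mkTables_valid {S N nu guard Klog Kpi Kexp kexp KI kI : ℕ} {T : Tables}
    (h : mkTables S N nu guard Klog Kpi Kexp kexp KI kI = some T) : T.Valid := by
  unfold mkTables at h
  simp only at h
  split_ifs at h with hc
  split at h
  · rename_i P A R hP hA hR
    simp only [Option.some.injEq] at h
    subst h
    obtain ⟨hS, hN, hnu⟩ := hc
    have hS' : 0 < S * 2 ^ guard := Nat.mul_pos hS (pow_pos (by norm_num) _)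
    obtain ⟨hsz, hmem⟩ := mkLogs_spec (S := S) (Klog := Klog) hS' N hA
    exact ⟨hS, hN, hnu, MI.mem_rescale hS' S (MI.mem_pi _ hP), hsz, hmem, hR⟩
  · simp at h

/-! ## Powers `n^{-s}` -/

/-- `n^{-s} = e^{-σ log n} · e^{-i t log n}` evaluated afresh from the tables. [folklore] -/
def cpowFresh (T : Tables) (sB : MC) (n : ℕ) : Option MC :=
  let L := T.logs.getD n default
  match MI.exp T.S T.Kexp T.kexp ((sB.re.mul T.S L).neg),
    MC.expI T.S T.KI T.kI T.piI ((sB.im.mul T.S L).neg) with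
  | some mag, some ph => some (ph.mulMI T.S mag)
  | _, _ => none

/-- One new entry of the power table. [folklore] -/
def powEntry (T : Tables) (sB : MC) (A : Array MC) (m : ℕ) : Option MC :=
  if m = 1 then some (MC.ofInt T.S 1)
  else if m.minFac = m then cpowFresh T sB m
  else
    match A[m.minFac]?, A[m / m.minFac]? with
    | some x, some y => some (MC.mul T.S x y)
    | _, _ => none

/-- The table `[junk, 1^{-s}, 2^{-s}, …, n^{-s}]` of enclosures (multiplicatively from the primes).
[folklore] -/
def powTable (T : Tables) (sB : MC) : ℕ → Option (Array MC)
  | 0 => some #[MC.ofInt T.S 0]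
  | m + 1 =>
    match powTable T sB m with
    | none => none
    | some A =>
      match powEntry T sB A (m + 1) with
      | none => none
      | some b => some (A.push b)

/-! ## The evaluator -/

/-- Sum of the table entries `1^{-s} + ⋯ + (N-1)^{-s}`. [folklore] -/
def sumPow (A : Array MC) : ℕ → MC → MC
  | 0, acc => acc
  | n + 1, acc => sumPow A n (acc.add (A.getD (n + 1) default))

/-- The Euler–Maclaurin main part `Σ_{n<N} n^{-s} + N · N^{-s}/(s-1) + ½ N^{-s}`. [folklore] -/
def mainBox (T : Tables) (sB : MC) (A : Array MC) : Option MC :=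
  let PN := A.getD T.N default
  match MC.divBox T.S (PN.mulInt T.N) (sB.sub (MC.ofInt T.S 1)) with
  | some q => some (((sumPow A (T.N - 1) (MC.ofInt T.S 0)).add q).add (PN.divNat 2))
  | none => none

/-- Accumulate the correction terms: from `T_k ∈ tk` and the ratios `r_k, r_{k+1}, …` produce
`Σ_{j=k}^{ν} T_j` added to `acc`; `T_{k+1} = T_k · r_k · (s+2k-1)(s+2k)/N²`. [folklore] -/
def termsAux (T : Tables) (sB : MC) : List ℚ → ℕ → MC → MC → MC
  | [], _, tk, acc => acc.add tk
  | r :: rs, k, tk, acc =>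
      let f := MC.mul T.S (sB.add (MC.ofInt T.S (2 * k - 1))) (sB.add (MC.ofInt T.S (2 * k)))
      let tk' := ((MC.mul T.S (tk.mulMI T.S (MI.ofFrac T.S r.num r.den)) f).divNat T.N).divNat T.N
      termsAux T sB rs (k + 1) tk' (acc.add tk)

/-- The sum of the correction terms `Σ_{k=1}^{ν} T_k`, `T_1 = s N^{-s} / (12 N)`. [folklore] -/
def termsBox (T : Tables) (sB : MC) (A : Array MC) : MC :=
  let PN := A.getD T.N default
  let t1 := ((MC.mul T.S sB PN).divNat 12).divNat T.N
  termsAux T sB T.ratios 1 t1 (MC.ofInt T.S 0)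

/-- Upper bound, at scale `S`, for `Π_{j<m} (|σ + j| + |t|)` over the box. [folklore] -/
def pochBound (T : Tables) (sB : MC) : ℕ → ℤ
  | 0 => T.S
  | j + 1 => Literature.Analysis.ValidatedNumerics.Numerics.cdiv (pochBound T sB j * ((sB.re.add (MI.ofInt T.S j)).absHi + sB.im.absHi)) T.S

/-- The remainder radius (scaled by `S`):
`⌈U · 33 · 25^{2ν+1} / (10 · 157^{2ν+1} · N^{2ν} · 2ν)⌉`, `U = pochBound (2ν+1)`. [folklore] -/
def remRadius (T : Tables) (sB : MC) : ℤ :=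
  Literature.Analysis.ValidatedNumerics.Numerics.cdiv (pochBound T sB (2 * T.nu + 1) * 33 * 25 ^ (2 * T.nu + 1))
    (10 * 157 ^ (2 * T.nu + 1) * (T.N : ℤ) ^ (2 * T.nu) * (2 * T.nu))

/-- **The certified evaluator**: a box containing `ζ(s)` for all `s` in `sB` (requires
`0 < lo (re sB)`; soundness `mem_zetaBox` additionally needs `s ≠ 1`). [folklore] -/
def zetaBox (T : Tables) (sB : MC) : Option MC :=
  if 0 < sB.re.lo then
    match powTable T sB T.N with
    | none => none
    | some A =>
      match mainBox T sB A with
      | none => none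
      | some M => some ((M.add (termsBox T sB A)).widen (remRadius T sB))
  else none

/-! ## Soundness -/

section Soundness

/-- `n^{-s} = e^{-i t log n} · e^{-σ log n}` for `n ≥ 1`. [folklore] -/
lemma natCast_cpow_neg_eq {n : ℕ} (hn : 1 ≤ n) (s : ℂ) :
    (n : ℂ) ^ (-s) = Complex.exp (((-(s.im * Real.log n) : ℝ) : ℂ) * I) *
      ((Real.exp (-(s.re * Real.log n)) : ℝ) : ℂ) := by
  have hn0 : (n : ℂ) ≠ 0 := by exact_mod_cast (show n ≠ 0 by omega)
  rw [cpow_def_of_ne_zero hn0, ← natCast_log, Complex.ofReal_exp, ← Complex.exp_add]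
  congr 1
  apply Complex.ext <;> simp <;> ring

variable {T : Tables} (hT : T.Valid) {s : ℂ} {sB : MC} (hs : MC.mem T.S s sB)
include hT hs

omit hT hs in
/-- Soundness of `cpowFresh`. [folklore] -/
theorem mem_cpowFresh (hT : T.Valid) (hs : MC.mem T.S s sB) {n : ℕ} (hn1 : 1 ≤ n)
    (hnN : n ≤ T.N) {B : MC} (h : cpowFresh T sB n = some B) : MC.mem T.S ((n : ℂ) ^ (-s)) B := by
  unfold cpowFresh at h
  simp only at h
  split at h
  · rename_i mag ph hmag hph
    simp only [Option.some.injEq] at h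
    subst h
    have hL := hT.mem_logs n hn1 hnN
    have h1 : MI.mem T.S (-(s.re * Real.log n)) ((sB.re.mul T.S (T.logs.getD n default)).neg) :=
      MI.mem_neg (MI.mem_mul hT.S_pos hs.1 hL)
    have h2 : MI.mem T.S (-(s.im * Real.log n)) ((sB.im.mul T.S (T.logs.getD n default)).neg) :=
      MI.mem_neg (MI.mem_mul hT.S_pos hs.2 hL)
    have hm := MI.mem_exp hT.S_pos hmag h1
    have hp := MC.mem_expI hT.S_pos hT.mem_pi hph h2
    rw [natCast_cpow_neg_eq hn1]
    exact MC.mem_mulMI hT.S_pos hp hm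
  · simp at h

omit hT hs in
/-- Soundness of the power table. [folklore] -/
theorem powTable_spec (hT : T.Valid) (hs : MC.mem T.S s sB) :
    ∀ (m : ℕ) {A : Array MC}, m ≤ T.N → powTable T sB m = some A →
      A.size = m + 1 ∧ ∀ n : ℕ, 1 ≤ n → n ≤ m → MC.mem T.S ((n : ℂ) ^ (-s)) (A.getD n default)
  | 0, A, _, h => by
    simp only [powTable, Option.some.injEq] at h
    subst h
    exact ⟨rfl, fun n h1 h2 ↦ by omega⟩
  | m + 1, A, hm, h => by
    simp only [powTable] at h
    split at h
    · simp at h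
    · rename_i A0 hA0
      split at h
      · simp at h
      · rename_i b hb
        simp only [Option.some.injEq] at h
        subst h
        obtain ⟨hsz, hmem⟩ := powTable_spec hT hs m (by omega) hA0
        refine ⟨by simp [hsz], fun n h1 h2 ↦ ?_⟩
        rcases Nat.lt_succ_iff_lt_or_eq.1 (Nat.lt_succ_of_le h2) with hlt | heq
        · have hlt' : n < A0.size := by rw [hsz]; omega
          have := hmem n h1 (Nat.lt_succ_iff.1 hlt)
          rw [Array.getD_eq_getD_getElem?, Array.getElem?_push_lt hlt', Option.getD_some]
          rw [Array.getD_eq_getD_getElem?, getElem?_pos A0 n hlt', Option.getD_some] at this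
          exact this
        · subst heq
          have hidx : (A0.push b)[m + 1]? = some b := by
            rw [← hsz]; exact Array.getElem?_push_size
          rw [Array.getD_eq_getD_getElem?, hidx, Option.getD_some]
          -- the new entry
          unfold powEntry at hb
          split_ifs at hb with h1' hp
          · simp only [Option.some.injEq] at hb
            subst hb
            rw [h1']
            simpa using MC.mem_ofInt T.S 1
          · exact mem_cpowFresh hT hs h1 hm hb
          · -- composite: `(m+1) = p * ((m+1)/p)`
            split at hb
            · rename_i x y hx hy
              simp only [Option.some.injEq] at hb
              subst hb
              set p := (m + 1).minFac with hpdef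
              have hpd : p ∣ m + 1 := Nat.minFac_dvd _
              have hpr : p.Prime := Nat.minFac_prime h1'
              have hp2 : 2 ≤ p := hpr.two_le
              have hple : p ≤ m + 1 := Nat.minFac_le (by omega)
              have hplt : p < m + 1 := lt_of_le_of_ne hple hp
              have hq1 : 1 ≤ (m + 1) / p := by
                rw [Nat.one_le_div_iff (by omega)]; exact hple
              have hqlt : (m + 1) / p < m + 1 := Nat.div_lt_self (by omega) (by omega)
              have hxm : MC.mem T.S ((p : ℂ) ^ (-s)) x := by
                have := hmem p (by omega) (by omega)
                rwa [Array.getD_eq_getD_getElem?, hx, Option.getD_some] at this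
              have hym : MC.mem T.S ((((m + 1) / p : ℕ) : ℂ) ^ (-s)) y := by
                have := hmem ((m + 1) / p) hq1 (by omega)
                rwa [Array.getD_eq_getD_getElem?, hy, Option.getD_some] at this
              have key : (((m + 1 : ℕ) : ℂ)) ^ (-s) = (p : ℂ) ^ (-s) * (((m + 1) / p : ℕ) : ℂ) ^ (-s) := by
                rw [← natCast_mul_natCast_cpow, ← Nat.cast_mul, Nat.mul_div_cancel' hpd]
              rw [key]
              exact MC.mem_mul hT.S_pos hxm hym
            · simp at hb

omit hT hs in
/-- Soundness of `sumPow`. [folklore] -/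
lemma sumPow_spec (hT : T.Valid) (hs : MC.mem T.S s sB) {A : Array MC} {M : ℕ}
    (hA : ∀ n : ℕ, 1 ≤ n → n ≤ M → MC.mem T.S ((n : ℂ) ^ (-s)) (A.getD n default)) :
    ∀ (n : ℕ) {acc : MC} {a : ℂ}, n ≤ M → MC.mem T.S a acc →
      MC.mem T.S (a + ∑ j ∈ Finset.Ico 1 (n + 1), (j : ℂ) ^ (-s)) (sumPow A n acc)
  | 0, acc, a, _, h => by simpa [sumPow] using h
  | n + 1, acc, a, hn, h => by
    simp only [sumPow]
    have h' := MC.mem_add h (hA (n + 1) (by omega) hn)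
    have := sumPow_spec hT hs hA n (by omega) h'
    convert this using 1
    rw [Finset.sum_Ico_succ_top (by omega)]
    ring

omit hT hs in
/-- Soundness of `mainBox`. [folklore] -/
theorem mem_mainBox (hT : T.Valid) (hs : MC.mem T.S s sB) {A : Array MC}
    (hA : ∀ n : ℕ, 1 ≤ n → n ≤ T.N → MC.mem T.S ((n : ℂ) ^ (-s)) (A.getD n default))
    {M : MC} (h : mainBox T sB A = some M) : MC.mem T.S (emMainZero T.N s) M := by
  unfold mainBox at h
  simp only at h
  split at h
  · rename_i q hq
    simp only [Option.some.injEq] at h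
    subst h
    have hN1 : 1 ≤ T.N := le_trans (by norm_num) hT.two_le_N
    have hPN := hA T.N hN1 le_rfl
    have hsum := sumPow_spec hT hs (M := T.N - 1) (fun n h1 h2 ↦ hA n h1 (by omega)) (T.N - 1)
      le_rfl (MC.mem_ofInt T.S 0)
    simp only [Int.cast_zero, zero_add, Nat.sub_add_cancel hN1] at hsum
    have hq' : MC.mem T.S ((T.N : ℂ) ^ (1 - s) / (s - 1)) q := by
      have h1 := MC.mem_divBox hT.S_pos hq (MC.mem_mulInt hPN (T.N : ℤ))
        (MC.mem_sub hs (MC.mem_ofInt T.S 1))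
      convert h1 using 1
      have hN0 : (T.N : ℂ) ≠ 0 := by exact_mod_cast (show T.N ≠ 0 by omega)
      rw [sub_eq_add_neg, cpow_add _ _ hN0, cpow_one]
      push_cast
      ring
    have hhalf : MC.mem T.S ((T.N : ℂ) ^ (-s) / 2) ((A.getD T.N default).divNat 2) := by
      have := MC.mem_divNat hPN (n := 2) (by norm_num)
      simpa using this
    unfold emMainZero
    simpa [add_assoc] using MC.mem_add (MC.mem_add hsum hq') hhalf
  · simp at h

omit hT hs in
/-- The recursion of the correction terms:
`T_{k+1} = T_k · (c_{k+1}/c_k)·(s+2k-1)(s+2k)/N²` written multiplicatively. [folklore] -/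
lemma emTerm_succ (hN : T.N ≠ 0) (k : ℕ) (hk : 1 ≤ k) (r : ℚ)
    (hr : emCoeff (k + 1) = emCoeff k * r) :
    emTerm T.N s (k + 1) =
      emTerm T.N s k * (r : ℂ) * ((s + ((2 * k - 1 : ℕ) : ℂ)) * (s + ((2 * k : ℕ) : ℂ))) / T.N / T.N := by
  have hc : ∀ j, ((bernoulli (2 * j) : ℚ) : ℂ) / (2 * j).factorial = ((emCoeff j : ℚ) : ℂ) := by
    intro j
    rw [emCoeff]
    push_cast
    rfl
  unfold emTerm
  rw [hc, hc, hr]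
  have e1 : 2 * (k + 1) - 1 = 2 * k - 1 + 1 + 1 := by omega
  rw [e1, emPoch_succ, emPoch_succ]
  have hN0 : (T.N : ℂ) ≠ 0 := by exact_mod_cast hN
  have hX : (T.N : ℂ) ^ (-(s + ((2 * k - 1 + 1 + 1 : ℕ) : ℂ))) =
      (T.N : ℂ) ^ (-(s + ((2 * k - 1 : ℕ) : ℂ))) / T.N / T.N := by
    rw [div_div, ← pow_two, ← cpow_natCast, ← cpow_sub _ _ hN0]
    congr 1
    push_cast
    ring
  rw [hX]
  have e2 : ((2 * k - 1 + 1 : ℕ) : ℂ) = ((2 * k : ℕ) : ℂ) := by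
    norm_cast; omega
  push_cast [e2]
  ring

omit hs in
/-- The ratios recorded in valid tables satisfy `c_{k+1} = c_k · r_k`. [folklore] -/
lemma ratios_spec : T.ratios.length = T.nu - 1 + 0 ∧
    ∀ i : ℕ, i + 1 < T.nu + 0 → emCoeff (i + 2) = emCoeff (i + 1) * T.ratios.getD i 0 := by
  have h := hT.ratios_eq
  unfold emRatios at h
  simp only at h
  split_ifs at h with hall
  simp only [Option.some.injEq] at h
  have hcs : ∀ j, j < T.nu + 2 → (emCoeffList T.nu).getD j 0 = emCoeff j := fun j hj ↦
    emCoeffList_getD hj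
  constructor
  · rw [← h]; simp
  · intro i hi
    rw [List.all_eq_true] at hall
    have hne := hall i (List.mem_range.2 (by omega))
    simp only [decide_eq_true_eq] at hne
    rw [hcs (i + 1) (by omega)] at hne
    rw [← h, List.getD_eq_getElem?_getD, List.getElem?_map, List.getElem?_range (by omega)]
    simp only [Option.map_some, Option.getD_some]
    rw [hcs (i + 2) (by omega), hcs (i + 1) (by omega)]
    field_simp

omit hT hs in
/-- Soundness of `termsAux`. [folklore] -/
lemma termsAux_spec (hT : T.Valid) (hs : MC.mem T.S s sB) :
    ∀ (rs : List ℚ) (k : ℕ) {tk acc : MC} {a : ℂ}, 1 ≤ k → k + rs.length = T.nu →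
      (∀ i : ℕ, i < rs.length → emCoeff (k + i + 1) = emCoeff (k + i) * rs.getD i 0) →
      MC.mem T.S (emTerm T.N s k) tk → MC.mem T.S a acc →
      MC.mem T.S (a + ∑ j ∈ Finset.Icc k T.nu, emTerm T.N s j) (termsAux T sB rs k tk acc)
  | [], k, tk, acc, a, hk, hlen, _, htk, hacc => by
    simp only [List.length_nil, add_zero] at hlen
    simp only [termsAux, ← hlen, Finset.Icc_self, Finset.sum_singleton]
    exact MC.mem_add hacc htk
  | r :: rs, k, tk, acc, a, hk, hlen, hrs, htk, hacc => by
    simp only [termsAux]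
    have hN0 : T.N ≠ 0 := by have := hT.two_le_N; omega
    have hr : emCoeff (k + 1) = emCoeff k * r := by
      have := hrs 0 (by simp)
      simpa using this
    have htk' : MC.mem T.S (emTerm T.N s (k + 1))
        (((MC.mul T.S (tk.mulMI T.S (MI.ofFrac T.S r.num r.den))
          (MC.mul T.S (sB.add (MC.ofInt T.S (2 * k - 1))) (sB.add (MC.ofInt T.S (2 * k))))).divNat
            T.N).divNat T.N) := by
      rw [emTerm_succ hN0 k hk r hr]
      have hrm : MI.mem T.S ((r : ℝ)) (MI.ofFrac T.S r.num r.den) := by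
        have := MI.mem_ofFrac T.S r.num (q := r.den) r.den_pos
        convert this using 1
        exact_mod_cast (Rat.num_div_den r).symm
      have h1 : MC.mem T.S (emTerm T.N s k * (r : ℂ)) (tk.mulMI T.S (MI.ofFrac T.S r.num r.den)) := by
        have := MC.mem_mulMI hT.S_pos htk hrm
        simpa only [Complex.ofReal_ratCast] using this
      have h2 : MC.mem T.S ((s + ((2 * k - 1 : ℕ) : ℂ)) * (s + ((2 * k : ℕ) : ℂ)))
          (MC.mul T.S (sB.add (MC.ofInt T.S (2 * k - 1))) (sB.add (MC.ofInt T.S (2 * k)))) := by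
        have ha := MC.mem_add hs (MC.mem_ofInt T.S (2 * (k : ℤ) - 1))
        have hb := MC.mem_add hs (MC.mem_ofInt T.S (2 * (k : ℤ)))
        have := MC.mem_mul hT.S_pos ha hb
        have e : (((2 * (k : ℤ) - 1 : ℤ)) : ℂ) = ((2 * k - 1 : ℕ) : ℂ) := by
          rw [Nat.cast_sub (by omega)]; push_cast; ring
        have e' : (((2 * (k : ℤ) : ℤ)) : ℂ) = ((2 * k : ℕ) : ℂ) := by push_cast; ring
        rw [e, e'] at this
        exact this
      have h3 := MC.mem_mul hT.S_pos h1 h2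
      have h4 := MC.mem_divNat (MC.mem_divNat h3 (n := T.N) (by omega)) (n := T.N) (by omega)
      exact h4
    have := termsAux_spec hT hs rs (k + 1) (by omega) (by simp at hlen ⊢; omega)
      (fun i hi ↦ by
        have := hrs (i + 1) (by simp; omega)
        simp only [List.getD_cons_succ] at this
        rw [show k + 1 + i + 1 = k + (i + 1) + 1 by ring, show k + 1 + i = k + (i + 1) by ring]
        exact this)
      htk' (MC.mem_add hacc htk)
    have hkle : k ≤ T.nu := by simp at hlen; omega
    have hsplit : ∑ j ∈ Finset.Icc k T.nu, emTerm T.N s j =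
        emTerm T.N s k + ∑ j ∈ Finset.Icc (k + 1) T.nu, emTerm T.N s j := by
      have : Finset.Icc k T.nu = insert k (Finset.Icc (k + 1) T.nu) := by
        ext j; simp; omega
      rw [this, Finset.sum_insert (by simp)]
    rw [hsplit, ← add_assoc]
    exact this

omit hT hs in
/-- Soundness of `termsBox`. [folklore] -/
theorem mem_termsBox (hT : T.Valid) (hs : MC.mem T.S s sB) {A : Array MC}
    (hA : ∀ n : ℕ, 1 ≤ n → n ≤ T.N → MC.mem T.S ((n : ℂ) ^ (-s)) (A.getD n default)) :
    MC.mem T.S (∑ j ∈ Finset.Icc 1 T.nu, emTerm T.N s j) (termsBox T sB A) := by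
  have hN1 : 1 ≤ T.N := le_trans (by norm_num) hT.two_le_N
  have hPN := hA T.N hN1 le_rfl
  obtain ⟨hlen, hrat⟩ := ratios_spec hT
  have ht1 : MC.mem T.S (emTerm T.N s 1) (((MC.mul T.S sB (A.getD T.N default)).divNat 12).divNat T.N) := by
    have := MC.mem_divNat (MC.mem_divNat (MC.mem_mul hT.S_pos hs hPN) (n := 12) (by norm_num))
      (n := T.N) hN1
    convert this using 1
    unfold emTerm
    have hb2 : (bernoulli (2 * 1) : ℚ) = 1 / 6 := by
      rw [show 2 * 1 = 2 by rfl, bernoulli_eq_bernoulli'_of_ne_one (by norm_num), bernoulli'_two]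
    rw [hb2]
    have hN0 : (T.N : ℂ) ≠ 0 := by exact_mod_cast (show T.N ≠ 0 by omega)
    simp only [show 2 * 1 - 1 = 1 by rfl, emPoch_one, show (2 * 1).factorial = 2 by rfl]
    rw [show -(s + ((1 : ℕ) : ℂ)) = -s - 1 by push_cast; ring, cpow_sub _ _ hN0, cpow_one]
    push_cast
    field_simp
    ring
  have := termsAux_spec hT hs T.ratios 1 (by norm_num) (by rw [hlen]; have := hT.nu_ne; omega)
    (fun i hi ↦ by
      have := hrat i (by rw [hlen] at hi; omega)
      rw [show 1 + i + 1 = i + 2 by ring, show 1 + i = i + 1 by ring]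
      exact this)
    ht1 (MC.mem_ofInt T.S 0)
  simpa [termsBox] using this

omit hT hs in
/-- Soundness of `pochBound`: `Π_{j<m} (|σ+j|+|t|) · S ≤ pochBound m`. [folklore] -/
lemma pochBound_spec (hT : T.Valid) (hs : MC.mem T.S s sB) :
    ∀ m : ℕ, (∏ j ∈ range m, (|s.re + j| + |s.im|)) * T.S ≤ (pochBound T sB m : ℝ)
  | 0 => by simp [pochBound]
  | m + 1 => by
    have ih := pochBound_spec hT hs m
    have hSr : (0 : ℝ) < T.S := by exact_mod_cast hT.S_pos
    have hSz : (0 : ℤ) < T.S := by exact_mod_cast hT.S_pos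
    simp only [pochBound]
    have ha : (|s.re + m| + |s.im|) * T.S ≤
        (((sB.re.add (MI.ofInt T.S m)).absHi + sB.im.absHi : ℤ) : ℝ) := by
      have h1 := MI.abs_le_absHi (MI.mem_add hs.1 (MI.mem_ofInt T.S (m : ℤ)))
      have h2 := MI.abs_le_absHi hs.2
      push_cast at h1 ⊢
      nlinarith
    have hP : 0 ≤ ∏ j ∈ range m, (|s.re + j| + |s.im|) :=
      prod_nonneg fun _ _ ↦ by positivity
    have key : (∏ j ∈ range (m + 1), (|s.re + j| + |s.im|)) * T.S * T.S ≤
        (pochBound T sB m : ℝ) * (((sB.re.add (MI.ofInt T.S m)).absHi + sB.im.absHi : ℤ) : ℝ) := by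
      rw [prod_range_succ]
      calc (∏ j ∈ range m, (|s.re + j| + |s.im|)) * (|s.re + m| + |s.im|) * T.S * T.S
          = ((∏ j ∈ range m, (|s.re + j| + |s.im|)) * T.S) * ((|s.re + m| + |s.im|) * T.S) := by
            ring
        _ ≤ (pochBound T sB m : ℝ) *
            (((sB.re.add (MI.ofInt T.S m)).absHi + sB.im.absHi : ℤ) : ℝ) :=
            mul_le_mul ih ha (by positivity) (le_trans (by positivity) ih)
    have hc := Literature.Analysis.ValidatedNumerics.Numerics.le_cdiv_mul_real
      (a := pochBound T sB m * ((sB.re.add (MI.ofInt T.S m)).absHi + sB.im.absHi)) hSz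
    push_cast at hc key ⊢
    exact le_of_mul_le_mul_right (key.trans hc) hSr

omit hT hs in
/-- Soundness of the remainder radius: `‖R_ν(s)‖ · S ≤ remRadius`. [folklore] -/
theorem norm_emRem_mul_le_remRadius (hT : T.Valid) (hs : MC.mem T.S s sB) (hσ : 0 < s.re) :
    ‖emRemHigher T.N T.nu s‖ * T.S ≤ (remRadius T sB : ℝ) := by
  have hN1 : 1 ≤ T.N := le_trans (by norm_num) hT.two_le_N
  have hSr : (0 : ℝ) < T.S := by exact_mod_cast hT.S_pos
  have hR := norm_emRemHigher_le_rat hN1 hσ hT.nu_ne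
  have hP := (norm_emPoch_le s (2 * T.nu + 1)).trans
    ((le_div_iff₀ hSr).2 (pochBound_spec hT hs (2 * T.nu + 1)))
  have hν0 : (0 : ℝ) < T.nu := by exact_mod_cast Nat.pos_of_ne_zero hT.nu_ne
  have hN0 : (0 : ℝ) < T.N := by exact_mod_cast hN1
  set U : ℤ := pochBound T sB (2 * T.nu + 1) with hU
  have hden : (0 : ℤ) < 10 * 157 ^ (2 * T.nu + 1) * (T.N : ℤ) ^ (2 * T.nu) * (2 * T.nu) := by
    have : (0 : ℤ) < T.N := by exact_mod_cast hN1
    have : (0 : ℤ) < T.nu := by exact_mod_cast Nat.pos_of_ne_zero hT.nu_ne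
    positivity
  have hc := Literature.Analysis.ValidatedNumerics.Numerics.div_le_cdiv (a := U * 33 * 25 ^ (2 * T.nu + 1)) hden
  unfold remRadius
  refine le_trans ?_ hc
  push_cast
  rw [le_div_iff₀ (by exact_mod_cast hden)]
  have hC : 0 ≤ (33 / 10 : ℝ) * (25 / 157) ^ (2 * T.nu + 1) := by positivity
  have hD : 0 ≤ 1 / ((T.N : ℝ) ^ (2 * T.nu) * (2 * T.nu)) := by positivity
  have h1 : ‖emRemHigher T.N T.nu s‖ ≤ ((U : ℝ) / T.S) * ((33 / 10 : ℝ) * (25 / 157) ^ (2 * T.nu + 1)) *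
      (1 / ((T.N : ℝ) ^ (2 * T.nu) * (2 * T.nu))) :=
    hR.trans (mul_le_mul_of_nonneg_right (mul_le_mul_of_nonneg_right hP hC) hD)
  have hUnn : (0 : ℝ) ≤ U := by
    have := pochBound_spec hT hs (2 * T.nu + 1)
    exact le_trans (by positivity) this
  calc ‖emRemHigher T.N T.nu s‖ * T.S * (10 * 157 ^ (2 * T.nu + 1) * (T.N : ℝ) ^ (2 * T.nu) * (2 * T.nu))
      ≤ ((U : ℝ) / T.S) * ((33 / 10 : ℝ) * (25 / 157) ^ (2 * T.nu + 1)) *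
          (1 / ((T.N : ℝ) ^ (2 * T.nu) * (2 * T.nu))) * T.S *
          (10 * 157 ^ (2 * T.nu + 1) * (T.N : ℝ) ^ (2 * T.nu) * (2 * T.nu)) := by
        gcongr
    _ = (U : ℝ) * 33 * 25 ^ (2 * T.nu + 1) := by
        rw [div_pow]
        field_simp

omit hT hs in
/-- **Soundness of the certified evaluator.** [folklore] -/
theorem mem_zetaBox (hT : T.Valid) (hs : MC.mem T.S s sB) (hs1 : s ≠ 1) {Z : MC}
    (h : zetaBox T sB = some Z) : MC.mem T.S (riemannZeta s) Z := by
  unfold zetaBox at h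
  split_ifs at h with hlo
  split at h
  · simp at h
  · rename_i A hA
    split at h
    · simp at h
    · rename_i M hM
      simp only [Option.some.injEq] at h
      subst h
      have hσ : 0 < s.re := MI.pos_of_lo_pos hs.1 hlo
      have hN1 : 1 ≤ T.N := le_trans (by norm_num) hT.two_le_N
      obtain ⟨-, hApow⟩ := powTable_spec hT hs T.N le_rfl hA
      have hmain := mem_mainBox hT hs hApow hM
      have hterms := mem_termsBox hT hs hApow
      have hsum := MC.mem_add hmain hterms
      rw [riemannZeta_eq_eulerMaclaurin_of_re_pos hN1 hσ hs1 T.nu]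
      apply MC.mem_widen hsum
      rw [show emMainZero T.N s + ∑ k ∈ Finset.Icc 1 T.nu, emTerm T.N s k + emRemHigher T.N T.nu s -
        (emMainZero T.N s + ∑ j ∈ Finset.Icc 1 T.nu, emTerm T.N s j) = emRemHigher T.N T.nu s by ring]
      exact norm_emRem_mul_le_remRadius hT hs hσ

end Soundness

end Literature.NumberTheory.LFunctions.ZetaNumerics
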